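import Mathlib.RingTheory.Localization.Integer
import Mathlib.LinearAlgebra.Matrix.Rank
import Mathlib.LinearAlgebra.Matrix.NonsingularInverse
import Mathlib.LinearAlgebra.LinearIndependent.Lemmas
import Mathlib.LinearAlgebra.Dimension.Constructions
import Mathlib.Algebra.MvPolynomial.Expand
import Mathlib.Algebra.MvPolynomial.Funext
import Literature.NumberTheory.Transcendental.ExpVarietiesDimension
import Literature.RingTheory.KrullDimension.AffineDimension
import HarnessLib

/-!
# The torus locus `Kⁿ × (Kˣ)ⁿ` is rotund: discharge of `isRotund_torusLocus`

Sibling proof file of `ExpVarieties.lean` (which stays untouched); it DISCHARGES the named fact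
`Literature.NumberTheory.Transcendental.isRotund_torusLocus` of that file:

* `Literature.NumberTheory.Transcendental.isRotund_torusLocus_holds : isRotund_torusLocus` — over an
  infinite field `K`, for every integer matrix `M ∈ Mₙ(ℤ)` the Zariski dimension of
  `[M](Kⁿ × (Kˣ)ⁿ) ⊆ K^{n ⊕ n}` is at least `rk_ℚ M` (`Literature.NumberTheory.Transcendental.IsRotund`,
  Zilber's "ex-normality" / Kirby's "rotundity" of the ambient group `G_n = 𝔾ₐⁿ × 𝔾ₘⁿ` itself).

Proof (valid in every characteristic; only the multiplicative half of `[M]` is used, because in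
characteristic `p` the additive half `x ↦ M x` may have rank `< rk_ℚ M`).  Let `r = rk_ℚ M`.

1. (`exists_int_dual_family`, linear algebra over `ℚ`.)  Choose `r` rows `e k` of `M` that are
   linearly independent over `ℚ`; the `r × n` submatrix has a rational right inverse, and clearing
   denominators gives integer vectors `q_l ∈ ℤⁿ` and `d ≥ 1` with `(M q_l)_{e k} = d δ_{kl}`.
2. (Generic point.)  In the rational function field `E = K(w_k : k < r)` consider the torus point
   `ζ = (0, y)`, `y_j = ∏_l w_l ^ {q_l j}`.  Then `([M] ζ)_{y, e k} = ∏_j y_j ^ {M_{e k, j}} = w_k ^ d`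
   (`prod_prod_zpow_eq`).
3. Every polynomial `h` over `K` vanishing on `[M](Kⁿ × (Kˣ)ⁿ)` vanishes at `[M] ζ`: clearing
   denominators (`exists_mul_prod_pow_eq_aeval` of `ExpVarietiesDimension.lean`),
   `h([M] z) (∏ y)^N = a(z)` on the torus points `z` of every extension field; `a` vanishes on the
   torus locus of the infinite field `K`, so `a · ∏ Yᵢ` vanishes on `K^{n ⊕ n}` and is `0`
   (`MvPolynomial.funext`), whence `a = 0` and `h([M] ζ) = 0`.
4. Hence the coordinate ring `K[X, Y] ⧸ I([M](Kⁿ × (Kˣ)ⁿ))` surjects onto `K[[M] ζ] ⊆ E`, an affine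
   domain containing the algebraically independent elements `w_k ^ d` (`aeval (X ^ d) = expand d`
   is injective), so its Krull dimension is at least `trdeg_K K[[M] ζ] ≥ r`
   (`le_zariskiDim_of_algebraicIndependent`, using `dim = trdeg` for affine domains,
   `Literature.RingTheory.KrullDimension.ringKrullDim_eq_trdeg`).

Sources.  The fact is vendored with the cite Zilber, *Pseudo-exponentiation on algebraically closed
fields of characteristic zero*, Ann. Pure Appl. Logic 132 (2005), §3 (not held here at the time of
writing; acquisition requested).  The definition of rotundity formalised by
`Literature.NumberTheory.Transcendental.IsRotund` is the one printed in Kirby, *A note on the axioms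
for Zilber's pseudo-exponential fields*, Notre Dame J. Formal Logic 54 (2013), §2 (arXiv:1006.0894,
held): "an irreducible subvariety `V` of `Gⁿ` is rotund iff for every `M ∈ Mat_{n×n}(ℤ)` we have
`dim M·V ≥ rk M`", `M` acting linearly on `𝔾ₐⁿ` and multiplicatively on `𝔾ₘⁿ`; that `Gⁿ` itself
satisfies it is immediate from the definition (`dim M·Gⁿ = 2 rk M` in characteristic zero) and
is not a numbered statement of Kirby's note.  The vendored fact asks for it over an arbitrary
infinite field, where the additive half can degenerate in positive characteristic; the argument
above (dimension of the closure of the image of the torus under a monomial map ≥ rank of the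
exponent matrix, via a generic point and transcendence degree) follows Bays–Kirby 2018, proof of
Prop. 7.3 (`dim (M·V)^{Zar} = td(M·b/A)` for `b` generic), as already used in
`ExpVarietiesDimension.lean`.

## References

* [Zilber2005] B. Zilber, Pseudo-exponentiation on algebraically closed fields of characteristic
  zero, Ann. Pure Appl. Logic 132 (2005) 67–95, §3, doi:10.1016/j.apal.2004.07.001.
* [Kirby2013] J. Kirby, A note on the axioms for Zilber's pseudo-exponential fields, Notre Dame
  J. Formal Logic 54 (2013), no. 3-4, §2, doi:10.1215/00294527-2143844, arXiv:1006.0894.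
* [BaysKirby2018ANT] M. Bays, J. Kirby, Pseudo-exponential maps, variants, and quasiminimality,
  Algebra & Number Theory 12 (2018), §7, proof of Prop. 7.3.
* [Matsumura1987] H. Matsumura, Commutative Ring Theory, Thm 5.6 (dimension = transcendence
  degree).
-/

noncomputable section

open MvPolynomial

universe u

namespace Literature.NumberTheory.Transcendental

/-! ### A lower bound for the Zariski dimension by algebraically independent functions -/

section LowerBound

variable {K : Type*} [Field K] {ι : Type*} [Finite ι]

/-- **Lower bound for `zariskiDim` by algebraically independent functions.** If a `K`-algebra map
`φ : K[X_ι] → B` into a domain kills every polynomial vanishing on `S ⊆ K^ι` (i.e. `φ` is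
"evaluation at a point of the closure of `S` with values in `B`"), and the images of finitely many
polynomials `g k` are algebraically independent over `K`, then their number is at most
`zariskiDim K S`: indeed `K[X] ⧸ I(S) ↠ K[X] ⧸ ker φ ≅ range φ`, an affine domain of Krull
dimension `trdeg_K (range φ) ≥ #κ` (Matsumura Thm 5.6). [cite: Matsumura1987, Thm 5.6] -/
theorem le_zariskiDim_of_algebraicIndependent {B : Type*} [CommRing B] [IsDomain B] [Algebra K B]
    (S : Set (ι → K)) (φ : MvPolynomial ι K →ₐ[K] B)
    (hφ : vanishingIdeal K S ≤ RingHom.ker φ) {κ : Type*} [Fintype κ]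
    (g : κ → MvPolynomial ι K) (hg : AlgebraicIndependent K fun k => φ (g k)) :
    (Fintype.card κ : WithBot ℕ∞) ≤ zariskiDim K S := by
  have h1 : ringKrullDim (MvPolynomial ι K ⧸ RingHom.ker φ) ≤
      ringKrullDim (MvPolynomial ι K ⧸ vanishingIdeal K S) :=
    ringKrullDim_le_of_surjective (Ideal.Quotient.factor hφ) (Ideal.Quotient.factor_surjective hφ)
  unfold zariskiDim
  refine le_trans ?_ h1
  have e : (MvPolynomial ι K ⧸ RingHom.ker φ) ≃ₐ[K] φ.range :=
    (Ideal.quotientEquivAlgOfEq K (AlgHom.ker_rangeRestrict φ).symm).trans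
      (Ideal.quotientKerAlgEquivOfSurjective (AlgHom.rangeRestrict_surjective φ))
  rw [ringKrullDim_eq_of_ringEquiv e.toRingEquiv]
  haveI : Algebra.FiniteType K φ.range :=
    Algebra.FiniteType.of_surjective φ.rangeRestrict (AlgHom.rangeRestrict_surjective φ)
  rw [Literature.RingTheory.KrullDimension.ringKrullDim_eq_trdeg K φ.range]
  have hfin : Algebra.trdeg K φ.range = Cardinal.toNat (Algebra.trdeg K φ.range) :=
    Literature.RingTheory.KrullDimension.trdeg_eq_toNat K φ.range
  let w : κ → φ.range := fun k => ⟨φ (g k), ⟨g k, rfl⟩⟩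
  have hw : AlgebraicIndependent K w :=
    AlgebraicIndependent.of_comp φ.range.val (by simpa [w, Function.comp_def] using hg)
  have hle := hw.lift_cardinalMk_le_trdeg
  rw [Cardinal.mk_fintype, Cardinal.lift_natCast, hfin, Cardinal.lift_natCast] at hle
  exact_mod_cast hle

end LowerBound

/-! ### Monomial bookkeeping -/

section ZPow

variable {G : Type*} [CommGroupWithZero G]

/-- `∏ᵢ a ^ fᵢ = a ^ (∑ᵢ fᵢ)` for integer exponents and `a ≠ 0`. [folklore] -/
theorem prod_zpow_eq_zpow_sum_of_ne_zero {ι : Type*} (s : Finset ι) {a : G} (ha : a ≠ 0)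
    (f : ι → ℤ) : ∏ i ∈ s, a ^ f i = a ^ ∑ i ∈ s, f i := by
  classical
  induction s using Finset.induction_on with
  | empty => simp
  | insert i s hi ih => rw [Finset.prod_insert hi, Finset.sum_insert hi, zpow_add₀ ha, ih]

/-- Reparametrising a monomial map: `∏ⱼ (∏ₗ w_l ^ q_l j) ^ mⱼ = ∏ₗ w_l ^ (∑ⱼ mⱼ q_l j)` for
nonzero `w_l`. [folklore] -/
theorem prod_prod_zpow_eq {κ ι : Type*} [Fintype κ] [Fintype ι] {w : κ → G} (hw : ∀ l, w l ≠ 0)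
    (q : κ → ι → ℤ) (m : ι → ℤ) :
    ∏ j, (∏ l, w l ^ q l j) ^ m j = ∏ l, w l ^ ∑ j, m j * q l j := by
  calc ∏ j, (∏ l, w l ^ q l j) ^ m j = ∏ j, ∏ l, w l ^ (m j * q l j) := by
        refine Finset.prod_congr rfl fun j _ => ?_
        rw [← Finset.prod_zpow]
        refine Finset.prod_congr rfl fun l _ => ?_
        rw [← zpow_mul, mul_comm]
    _ = ∏ l, ∏ j, w l ^ (m j * q l j) := Finset.prod_comm
    _ = ∏ l, w l ^ ∑ j, m j * q l j :=
        Finset.prod_congr rfl fun l _ => prod_zpow_eq_zpow_sum_of_ne_zero _ (hw l) _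

end ZPow

/-! ### Rows of an integer matrix and integer dual vectors -/

section IntegerDual

/-- **Integer dual vectors to `rk_ℚ M` rows.** For an integer matrix `M ∈ Mₙ(ℤ)` of rank `r` over
`ℚ` there are `r` rows `e k` and `r` integer vectors `q_l ∈ ℤⁿ` and `d ≥ 1` with
`(M q_l)_{e k} = d δ_{kl}`: take `ℚ`-linearly independent rows spanning the row space, a rational
right inverse of the resulting `r × n` submatrix (its rows being independent, `x ↦ M_e x` is onto
`ℚ^r`), and clear denominators. [folklore] -/
theorem exists_int_dual_family {n : ℕ} (M : Matrix (Fin n) (Fin n) ℤ) :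
    ∃ (κ : Type) (_ : Fintype κ) (e : κ → Fin n) (q : κ → Fin n → ℤ) (d : ℕ), 0 < d ∧
      Fintype.card κ = (M.map (Int.cast : ℤ → ℚ)).rank ∧
      (∀ k, ∑ j, M (e k) j * q k j = d) ∧
      ∀ k l, k ≠ l → ∑ j, M (e k) j * q l j = 0 := by
  classical
  set A : Matrix (Fin n) (Fin n) ℚ := M.map (Int.cast : ℤ → ℚ) with hA
  obtain ⟨κ, a, ha, hspan, hli⟩ := exists_linearIndependent' ℚ A.row
  haveI : Finite κ := Finite.of_injective a ha
  letI : Fintype κ := Fintype.ofFinite κ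
  have hcard : Fintype.card κ = A.rank := by
    rw [Matrix.rank_eq_finrank_span_row, ← hspan, finrank_span_eq_card hli]
  -- the submatrix of the chosen rows has independent rows, hence `x ↦ B x` is onto
  set B : Matrix κ (Fin n) ℚ := A.submatrix a id with hB
  have hBrow : LinearIndependent ℚ B.row := hli
  have hsurj : Function.Surjective B.mulVec := by
    have hr : B.rank = Fintype.card κ := hBrow.rank_matrix
    have h1 : Module.finrank ℚ (LinearMap.range B.mulVecLin) = Module.finrank ℚ (κ → ℚ) := by
      rw [Module.finrank_fintype_fun_eq_card]; exact hr
    have h2 : LinearMap.range B.mulVecLin = ⊤ := Submodule.eq_top_of_finrank_eq h1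
    exact LinearMap.range_eq_top.1 h2
  obtain ⟨C, hC⟩ := Matrix.mulVec_surjective_iff_exists_right_inverse.1 hsurj
  -- clear denominators in `C`
  obtain ⟨b, hb⟩ := IsLocalization.exist_integer_multiples_of_finite (nonZeroDivisors ℤ)
    (fun p : Fin n × κ => C p.1 p.2)
  have hb0 : (b : ℤ) ≠ 0 := nonZeroDivisors.coe_ne_zero b
  choose z hz using hb
  -- the key identity over `ℚ`: `∑ⱼ M (a k) j * (b z_{j l}) = b² (B C)_{k l}`
  have key : ∀ k l, ((∑ j, M (a k) j * (b * z (j, l)) : ℤ) : ℚ) =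
      (b : ℚ) * (b : ℚ) * (1 : Matrix κ κ ℚ) k l := by
    intro k l
    have hkl : ∑ j, A (a k) j * C j l = (1 : Matrix κ κ ℚ) k l := by
      rw [← hC, Matrix.mul_apply]
      rfl
    have hz' : ∀ j, ((z (j, l) : ℤ) : ℚ) = (b : ℚ) * C j l := fun j => by
      have := hz (j, l)
      rwa [zsmul_eq_mul, eq_intCast] at this
    have hAM : ∀ j, (M (a k) j : ℚ) = A (a k) j := fun j => rfl
    rw [← hkl, Finset.mul_sum, Int.cast_sum]
    refine Finset.sum_congr rfl fun j _ => ?_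
    rw [Int.cast_mul, Int.cast_mul, hz', hAM]
    ring
  have hbb : (((b : ℤ).natAbs * (b : ℤ).natAbs : ℕ) : ℤ) = b * b := Int.natAbs_mul_self' _
  refine ⟨κ, inferInstance, a, fun l j => b * z (j, l), (b : ℤ).natAbs * (b : ℤ).natAbs,
    Nat.mul_pos (Int.natAbs_pos.2 hb0) (Int.natAbs_pos.2 hb0), hcard, fun k => ?_,
    fun k l hkl => ?_⟩
  · rw [hbb]
    apply Int.cast_injective (α := ℚ)
    rw [key, Matrix.one_apply_eq, mul_one, Int.cast_mul]
  · apply Int.cast_injective (α := ℚ)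
    rw [key, Matrix.one_apply_ne hkl, mul_zero, Int.cast_zero]

end IntegerDual

/-! ### Algebraic independence of `d`-th powers of the variables -/

section Expand

/-- The `d`-th powers of the variables, `d ≥ 1`, are algebraically independent: evaluation at
`(X_k ^ d)_k` is `MvPolynomial.expand d`, which is injective. [folklore] -/
theorem algebraicIndependent_X_pow (K : Type*) [CommRing K] (κ : Type*) {d : ℕ} (hd : 0 < d) :
    AlgebraicIndependent K fun k : κ => (X k ^ d : MvPolynomial κ K) := by
  rw [algebraicIndependent_iff_injective_aeval]
  have : (aeval fun k : κ => (X k ^ d : MvPolynomial κ K)) = expand d :=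
    MvPolynomial.algHom_ext fun k => by simp [expand_X]
  rw [this]
  exact expand_injective hd

end Expand

/-! ### The discharge -/

section Main

variable {K : Type u} [Field K] {n : ℕ}

/-- **The torus locus `Kⁿ × (Kˣ)ⁿ` is rotund** (discharge of `isRotund_torusLocus`): over an
infinite field `K`, `rk_ℚ M ≤ zariskiDim K ([M](Kⁿ × (Kˣ)ⁿ))` for every `M ∈ Mₙ(ℤ)`.  With
`q_l, d, e` as in `exists_int_dual_family`, the torus point `ζ = (0, (∏ₗ w_l ^ q_l j)ⱼ)` of the
rational function field `E = K(w_1, …, w_r)` has `([M] ζ)_{y, e k} = w_k ^ d`; every polynomial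
vanishing on `[M](Kⁿ × (Kˣ)ⁿ)` vanishes at `[M] ζ` (clearing denominators and
`MvPolynomial.funext` over the infinite field `K`), so the coordinate ring of the closure surjects
onto the affine domain `K[[M] ζ] ∋ w_k ^ d`, of dimension `= trdeg ≥ r`.  Rotundity
(`dim M·V ≥ rk M` for all `M ∈ Mₙ(ℤ)`): Zilber 2005 §3; Kirby, Notre Dame J. Formal Logic 54
(2013) §2; the generic-point computation is that of Bays–Kirby 2018, proof of Prop. 7.3.
[cite: Zilber2005, §3] -/
theorem isRotund_torusLocus_holds : isRotund_torusLocus (K := K) (n := n) := by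
  intro hK M
  classical
  obtain ⟨κ, hκ, e, q, d, hd, hcard, hMq, hMq0⟩ := exists_int_dual_family M
  -- the rational function field in `κ` variables and the torus point `ζ = (0, w^q)`
  let Rκ := MvPolynomial κ K
  let E := FractionRing (MvPolynomial κ K)
  let w : κ → E := fun l => algebraMap Rκ E (X l)
  have hw : ∀ l, w l ≠ 0 := fun l =>
    (map_ne_zero_iff _ (IsFractionRing.injective Rκ E)).2 (X_ne_zero l)
  let ζ : Fin n ⊕ Fin n → E := Sum.elim (fun _ => 0) (fun j => ∏ l, w l ^ q l j)
  have hζ : ζ ∈ torusLocus E n := fun j => by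
    simp only [ζ, Sum.elim_inr]
    exact Finset.prod_ne_zero_iff.2 fun l _ => zpow_ne_zero _ (hw l)
  let φ : MvPolynomial (Fin n ⊕ Fin n) K →ₐ[K] E := aeval (matrixAct M ζ)
  -- (1) `φ` kills the vanishing ideal of `[M](torus locus)`
  have hφ : vanishingIdeal K (matrixAct M '' torusLocus K n) ≤ RingHom.ker φ := by
    intro h hh
    rw [RingHom.mem_ker]
    obtain ⟨N, a, hNa⟩ := exists_mul_prod_pow_eq_aeval M h
    -- `a` vanishes on the torus locus of `K`, hence `a * ∏ Y = 0`, hence `a = 0`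
    have ha0 : a = 0 := by
      have hprod : a * ∏ i, X (Sum.inr i) = 0 := by
        apply MvPolynomial.funext
        intro z
        rw [map_zero, map_mul, map_prod]
        by_cases hz : z ∈ torusLocus K n
        · have h1 : aeval z a = 0 := by
            rw [← hNa z hz, (mem_vanishingIdeal_iff.1 hh) _ ⟨z, hz, rfl⟩, zero_mul]
          have h1' : eval z a = 0 := by rwa [← coe_aeval_eq_eval]
          rw [h1', zero_mul]
        · simp only [mem_torusLocus_iff, not_forall, not_not] at hz
          obtain ⟨i, hi⟩ := hz
          simp only [eval_X]
          rw [Finset.prod_eq_zero (Finset.mem_univ i) hi, mul_zero]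
      exact (mul_eq_zero.1 hprod).resolve_right
        (Finset.prod_ne_zero_iff.2 fun i _ => X_ne_zero _)
    have := hNa ζ hζ
    rw [ha0, map_zero] at this
    exact (mul_eq_zero.1 this).resolve_right
      (pow_ne_zero _ (Finset.prod_ne_zero_iff.2 fun i _ => hζ i))
  -- (2) `φ (Y_{e k}) = w_k ^ d`
  have hφY : ∀ k, φ (X (Sum.inr (e k))) = w k ^ d := by
    intro k
    simp only [φ, aeval_X, matrixAct_inr, ζ, Sum.elim_inr]
    rw [prod_prod_zpow_eq hw q (fun j => M (e k) j)]
    rw [Finset.prod_eq_single k (fun l _ hlk => by rw [hMq0 k l (Ne.symm hlk), zpow_zero])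
      (fun h => absurd (Finset.mem_univ k) h), hMq k, zpow_natCast]
  -- (3) these are algebraically independent over `K`
  have hind : AlgebraicIndependent K fun k => φ (X (Sum.inr (e k))) := by
    simp_rw [hφY]
    have h0 := (algebraicIndependent_X_pow K κ hd).map'
      (f := IsScalarTower.toAlgHom K Rκ E) (IsFractionRing.injective Rκ E)
    convert h0 using 1
    funext k
    simp [w, Rκ, map_pow]
  -- (4) conclude by the dimension bound
  have := le_zariskiDim_of_algebraicIndependent (matrixAct M '' torusLocus K n) φ hφ
    (fun k => X (Sum.inr (e k))) hind
  rwa [hcard] at this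

end Main

end Literature.NumberTheory.Transcendental
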